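import Mathlib
import Summits.KontsevichZagierPeriods.Zeta5Search.LaiDecayStirling
import Summits.KontsevichZagierPeriods.Zeta5Search.WellPoisedFaceBoundaryRate
import HarnessLib

/-!
# ζ(5) search — the TAIL of Lai's box series is negligible: `∀ B, ∃ K, ∀ᶠ n, Σ_{ν > Kn} C_n R_n(ν) ≤ e^{nB}`
# (fam-indep, κ₃ ladder, gen 5; decay target D3)

HONEST FRAMING: systematic search; no irrationality claim unless certified.

OUR work (Summit side; cell `pub-zeta5`, family `indep`, planner seat gen 5, STAGED for the lane). Target (D3) of
`LaiDecaySplit` = the `tail` field of `LaiDecayInputs J r M δ (laiC J r M · δ)`: because the series is BALANCED with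
room to spare — `d := Σ_j (M − 2δ_j) − 2r ≥ 1` (κ₃ ladder: 26070 − 4360) — the summand decays like `ν^{−(dn+J−1)}`:

* `laiTailExp J r M δ n = Σ_j((M−2δ_j)n+1) − (2rn+1)` and **`laiTermR_laiC_le_div_pow`**: for `ν ≥ (M+r)n + 2`,
  `C_n R_n(ν) ≤ 3·2^{rn}·C_n / ν^{laiTailExp}` (crude: numerator factors ≤ ν resp. ≤ 2ν, block factors ≥ ν);
* **`tsum_le_of_le_div_pow`** — `Σ_k f k ≤ A·V²/(V^e (V−1))` when `0 ≤ f k ≤ A/(k+V)^e`, `e, V ≥ 2`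
  (telescoping `1/ν^e ≤ V^{2−e}(1/(ν−1) − 1/ν)`; no summability needed, `Real.tsum_le_of_sum_range_le`);
* **`log_laiC_le`** — `log C_n ≤ d'·n log n + c₁ n + J(log(Mn)/2 + 1)` with `d' = Σ_j(M−2δ_j) − 2r` (Stirling via
  the tree's `WellPoisedFaceRate.logFactErr_bounds`), so the `n log n` of `C_n` is EXACTLY eaten by `ν^{−dn}` at `ν ≈ Kn`;
* **`laiTermR_laiC_tail`** — `∀ B : ℝ, ∃ K : ℕ, ∀ᶠ n, Σ' k, C_n R_n(k + Kn + 1) ≤ exp(n B)` (`2 ≤ J`, `2δ_j < M`,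
  `2r < Σ_j(M−2δ_j)`): with `B := f(x₀)` this is the `tail` field (and `K` the field `K`).

With FR 12–14 this closes every field of `LaiDecayInputs` at a ladder point (the instance is assembled in
`LaiDecayKappa3`). MANUSCRIPT-LEVEL CANDIDATE context only ('κ₃ ≤ 73'): no rate value, margin or dimension statement.

References: [Lai2024BallRivoal] L. Lai, arXiv:2407.14236, §13; families/indep/DECAY-L1.md §2 (Prop. 2.4, tail step).
-/

open Finset Filter Topology
open scoped Nat

namespace Summit.KontsevichZagierPeriods.Zeta5Search

open WellPoisedFaceRate (logFactErr log_factorial_eq logFactErr_bounds logFactErr_zero tendsto_log_linear_div)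

noncomputable section

variable {J r M : ℕ} {δ : Fin J → ℕ}

/-! ### The decay exponent and the crude pointwise bound -/

/-- The ν-decay exponent `e_n = Σ_j((M−2δ_j)n+1) − (2rn+1)` of `C_n R_n(ν)` (natural-number subtraction; see
`laiTailExp_spec`). [this file] -/
def laiTailExp (J r M : ℕ) (δ : Fin J → ℕ) (n : ℕ) : ℕ := (∑ j, ((M - 2 * δ j) * n + 1)) - (2 * r * n + 1)

/-- `Σ_j ((M−2δ_j)n + 1) = (Σ_j (M−2δ_j))·n + J`. [this file] -/
theorem sum_block_len (J M : ℕ) (δ : Fin J → ℕ) (n : ℕ) :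
    ∑ j, ((M - 2 * δ j) * n + 1) = (∑ j, (M - 2 * δ j)) * n + J := by
  rw [sum_add_distrib, sum_const, card_univ, Fintype.card_fin, smul_eq_mul, mul_one, sum_mul]

/-- Under `2r < Σ_j(M−2δ_j)` the subtraction in `laiTailExp` is genuine: `e_n + (2rn+1) = Σ_j((M−2δ_j)n+1)`,
and `e_n ≥ n + J − 1`. [this file] -/
theorem laiTailExp_spec (hd : 2 * r < ∑ j, (M - 2 * δ j)) (n : ℕ) :
    laiTailExp J r M δ n + (2 * r * n + 1) = ∑ j, ((M - 2 * δ j) * n + 1) ∧ n + J ≤ laiTailExp J r M δ n + 1 := by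
  have hJ : 1 ≤ J := by
    rcases Nat.eq_zero_or_pos J with h | h
    · subst h; simp at hd
    · exact h
  have hmul : (2 * r + 1) * n ≤ (∑ j, (M - 2 * δ j)) * n := Nat.mul_le_mul_right n hd
  unfold laiTailExp
  rw [sum_block_len]
  constructor
  · have : 2 * r * n + 1 ≤ (∑ j, (M - 2 * δ j)) * n + J := by nlinarith
    omega
  · have : (2 * r + 1) * n = 2 * r * n + n := by ring
    omega

/-- **Crude pointwise bound**: for `ν ≥ (M+r)n + 2`, `C_n R_n(ν) ≤ 3·2^{rn}·C_n / ν^{e_n}`. [this file] -/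
theorem laiTermR_laiC_le_div_pow (hd : 2 * r < ∑ j, (M - 2 * δ j)) {n ν : ℕ} (hν : (M + r) * n + 2 ≤ ν) :
    laiTermR J r M n δ (fun m => laiC J r M m δ) ν ≤
      3 * 2 ^ (r * n) * ((laiC J r M n δ : ℚ) : ℝ) / (ν : ℝ) ^ laiTailExp J r M δ n := by
  have hsplit : (M + r) * n = M * n + r * n := add_mul M r n
  have hν1 : 1 ≤ ν := by omega
  have hrn : r * n < ν := by omega
  have hνR : ((M : ℝ) + r) * n + 2 ≤ ν := by exact_mod_cast hν
  have hν0 : (0 : ℝ) < ν := by exact_mod_cast (show 0 < ν by omega)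
  have hM0 : (0 : ℝ) ≤ (M : ℝ) * n := by positivity
  have hr0 : (0 : ℝ) ≤ (r : ℝ) * n := by positivity
  -- numerator
  have hNum : ((laiNum r M n (ν : ℚ) : ℚ) : ℝ) ≤ 3 * (ν : ℝ) * ((ν : ℝ) ^ (r * n) * ((2 * (ν : ℝ)) ^ (r * n))) := by
    unfold laiNum
    push_cast
    have hP1 : ∏ i ∈ range (r * n), ((ν : ℝ) - ((i : ℝ) + 1)) ≤ (ν : ℝ) ^ (r * n) := by
      calc ∏ i ∈ range (r * n), ((ν : ℝ) - ((i : ℝ) + 1)) ≤ ∏ _i ∈ range (r * n), (ν : ℝ) :=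
            prod_le_prod (fun i hi => by
                have : ((i : ℝ) + 1) ≤ r * n := by exact_mod_cast (mem_range.1 hi : i < r * n)
                have : (r : ℝ) * n < ν := by exact_mod_cast hrn
                linarith)
              (fun i _ => by linarith [show (0 : ℝ) ≤ (i : ℝ) from Nat.cast_nonneg _])
        _ = (ν : ℝ) ^ (r * n) := by rw [prod_const, card_range]
    have hP1' : 0 ≤ ∏ i ∈ range (r * n), ((ν : ℝ) - ((i : ℝ) + 1)) :=
      prod_nonneg fun i hi => by
        have : ((i : ℝ) + 1) ≤ r * n := by exact_mod_cast (mem_range.1 hi : i < r * n)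
        have : (r : ℝ) * n < ν := by exact_mod_cast hrn
        linarith
    have hP2 : ∏ i ∈ range (r * n), ((ν : ℝ) + (M : ℝ) * n + ((i : ℝ) + 1)) ≤ (2 * (ν : ℝ)) ^ (r * n) := by
      calc ∏ i ∈ range (r * n), ((ν : ℝ) + (M : ℝ) * n + ((i : ℝ) + 1)) ≤ ∏ _i ∈ range (r * n), (2 * (ν : ℝ)) :=
            prod_le_prod (fun i _ => by positivity)
              (fun i hi => by
                have : ((i : ℝ) + 1) ≤ r * n := by exact_mod_cast (mem_range.1 hi : i < r * n)
                linarith)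
        _ = (2 * (ν : ℝ)) ^ (r * n) := by rw [prod_const, card_range]
    have h3 : 2 * (ν : ℝ) + (M : ℝ) * n ≤ 3 * ν := by linarith
    calc (2 * (ν : ℝ) + (M : ℝ) * n) * (∏ i ∈ range (r * n), ((ν : ℝ) - ((i : ℝ) + 1))) *
          (∏ i ∈ range (r * n), ((ν : ℝ) + (M : ℝ) * n + ((i : ℝ) + 1)))
        ≤ (3 * (ν : ℝ)) * (ν : ℝ) ^ (r * n) * (2 * (ν : ℝ)) ^ (r * n) :=
          mul_le_mul (mul_le_mul h3 hP1 hP1' (by positivity)) hP2 (prod_nonneg fun i _ => by positivity)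
            (by positivity)
      _ = 3 * (ν : ℝ) * ((ν : ℝ) ^ (r * n) * ((2 * (ν : ℝ)) ^ (r * n))) := by ring
  -- denominator
  have hDen : (ν : ℝ) ^ (∑ j, ((M - 2 * δ j) * n + 1)) ≤ ((laiDen J M n δ (ν : ℚ) : ℚ) : ℝ) := by
    unfold laiDen laiBlock
    push_cast
    rw [← prod_pow_eq_pow_sum]
    refine prod_le_prod (fun j _ => by positivity) fun j _ => ?_
    calc (ν : ℝ) ^ ((M - 2 * δ j) * n + 1) = ∏ _i ∈ range ((M - 2 * δ j) * n + 1), (ν : ℝ) := by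
          rw [prod_const, card_range]
      _ ≤ ∏ i ∈ range ((M - 2 * δ j) * n + 1), ((ν : ℝ) + ((δ j : ℝ) * n) + (i : ℝ)) :=
          prod_le_prod (fun i _ => hν0.le) fun i _ => by
            have : (0 : ℝ) ≤ (δ j : ℝ) * n := by positivity
            have : (0 : ℝ) ≤ (i : ℝ) := Nat.cast_nonneg _
            linarith
      _ = _ := prod_congr rfl fun i _ => by ring
  have hDen0 : (0 : ℝ) < (ν : ℝ) ^ (∑ j, ((M - 2 * δ j) * n + 1)) := by positivity
  have hC := laiC_cast_pos J r M n δ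
  -- assemble
  obtain ⟨hspec, -⟩ := laiTailExp_spec (J := J) (δ := δ) hd n
  unfold laiTermR laiCore
  push_cast
  calc ((laiC J r M n δ : ℚ) : ℝ) * (((laiNum r M n (ν : ℚ) : ℚ) : ℝ) / ((laiDen J M n δ (ν : ℚ) : ℚ) : ℝ))
      ≤ ((laiC J r M n δ : ℚ) : ℝ) * ((3 * (ν : ℝ) * ((ν : ℝ) ^ (r * n) * ((2 * (ν : ℝ)) ^ (r * n)))) /
          (ν : ℝ) ^ (∑ j, ((M - 2 * δ j) * n + 1))) := by
        refine mul_le_mul_of_nonneg_left (div_le_div₀ (by positivity) hNum hDen0 hDen) hC.le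
    _ = 3 * 2 ^ (r * n) * ((laiC J r M n δ : ℚ) : ℝ) / (ν : ℝ) ^ laiTailExp J r M δ n := by
        rw [← hspec, pow_add, pow_succ, mul_pow]
        field_simp
        ring

/-! ### Summing a `ν^{-e}` tail by telescoping -/

/-- **Tail summation**: if `0 ≤ f k ≤ A/(k+V)^e` with `A ≥ 0`, `e ≥ 2`, `V ≥ 2`, then
`Σ' k, f k ≤ A·V²/(V^e·(V−1))` (no summability hypothesis). [folklore; this file] -/
theorem tsum_le_of_le_div_pow {A : ℝ} (hA : 0 ≤ A) {e V : ℕ} (he : 2 ≤ e) (hV : 2 ≤ V) (f : ℕ → ℝ)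
    (hf0 : ∀ k, 0 ≤ f k) (hf : ∀ k, f k ≤ A / (((k + V : ℕ)) : ℝ) ^ e) :
    ∑' k, f k ≤ A * (V : ℝ) ^ 2 / ((V : ℝ) ^ e * ((V : ℝ) - 1)) := by
  have hV2 : (2 : ℝ) ≤ V := by exact_mod_cast hV
  obtain ⟨e', rfl⟩ : ∃ e', e = e' + 2 := ⟨e - 2, by omega⟩
  set g : ℕ → ℝ := fun i => 1 / ((i : ℝ) + V - 1) with hg
  set c : ℝ := A * (V : ℝ) ^ 2 / (V : ℝ) ^ (e' + 2) with hc
  have hc0 : 0 ≤ c := by positivity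
  -- pointwise comparison with the telescoping sequence
  have key : ∀ k : ℕ, f k ≤ c * (g k - g (k + 1)) := by
    intro k
    refine (hf k).trans ?_
    have hm : (V : ℝ) ≤ ((k + V : ℕ) : ℝ) := by push_cast; linarith [(Nat.cast_nonneg k : (0 : ℝ) ≤ k)]
    set m : ℝ := ((k + V : ℕ) : ℝ) with hmdef
    have hm1 : 1 ≤ m - 1 := by linarith
    have hgk : g k = 1 / (m - 1) := by simp only [hg, hmdef]; push_cast; ring_nf
    have hgk1 : g (k + 1) = 1 / m := by simp only [hg, hmdef]; push_cast; ring_nf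
    rw [hgk, hgk1, hc]
    have hm0 : 0 < m := by linarith
    have hVne : (V : ℝ) ≠ 0 := ne_of_gt (by linarith)
    have hVe0 : (V : ℝ) ^ e' ≠ 0 := pow_ne_zero _ hVne
    have hV20 : (V : ℝ) ^ 2 ≠ 0 := pow_ne_zero _ hVne
    rw [div_sub_div _ _ (by linarith) hm0.ne', one_mul, mul_one, show m - (m - 1) = (1 : ℝ) by ring]
    rw [div_le_iff₀ (by positivity)]
    have hpow : (V : ℝ) ^ e' ≤ m ^ e' := pow_le_pow_left₀ (by linarith) hm e'
    have hVe : (0 : ℝ) < (V : ℝ) ^ (e' + 2) := by positivity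
    calc A = A * (V : ℝ) ^ 2 / (V : ℝ) ^ (e' + 2) * (V : ℝ) ^ e' := by
          rw [pow_add, div_mul_eq_mul_div, eq_div_iff (mul_ne_zero hVe0 hV20)]; ring
      _ ≤ A * (V : ℝ) ^ 2 / (V : ℝ) ^ (e' + 2) * (1 / ((m - 1) * m)) * m ^ (e' + 2) := by
          rw [mul_assoc (A * (V : ℝ) ^ 2 / (V : ℝ) ^ (e' + 2))]
          refine mul_le_mul_of_nonneg_left ?_ (by positivity)
          rw [pow_add, one_div_mul_eq_div, le_div_iff₀ (by positivity)]
          calc (V : ℝ) ^ e' * ((m - 1) * m) ≤ m ^ e' * ((m - 1) * m) :=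
                mul_le_mul_of_nonneg_right hpow (mul_nonneg (by linarith) hm0.le)
            _ ≤ m ^ e' * m ^ 2 := by
                refine mul_le_mul_of_nonneg_left ?_ (pow_nonneg hm0.le e')
                nlinarith
  -- partial sums
  refine Real.tsum_le_of_sum_range_le hf0 fun N => ?_
  calc ∑ k ∈ range N, f k ≤ ∑ k ∈ range N, c * (g k - g (k + 1)) := sum_le_sum fun k _ => key k
    _ = c * (g 0 - g N) := by rw [← mul_sum, sum_range_sub']
    _ ≤ c * g 0 := by
        have : 0 ≤ g N := by
          simp only [hg]; exact div_nonneg zero_le_one (by linarith [(Nat.cast_nonneg N : (0 : ℝ) ≤ N)])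
        nlinarith
    _ = A * (V : ℝ) ^ 2 / ((V : ℝ) ^ (e' + 2) * ((V : ℝ) - 1)) := by
        simp only [hg, hc, Nat.cast_zero, zero_add]
        rw [mul_one_div, div_div]

/-! ### `log C_n` to first order -/

/-- **Stirling for the constant**: `log C_n ≤ (Σ_j u_j − 2r)·n log n + (Σ_j (u_j log u_j − u_j) + 2r)·n
+ J(log(Mn)/2 + 1)`, `u_j = M − 2δ_j ≥ 1`, `n ≥ 1`. [this file] -/
theorem log_laiC_le (hδ : ∀ j, 2 * δ j < M) {n : ℕ} (hn : 1 ≤ n) :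
    Real.log ((laiC J r M n δ : ℚ) : ℝ) ≤
      ((∑ j, (((M - 2 * δ j : ℕ)) : ℝ)) - 2 * r) * (n * Real.log n) +
        ((∑ j, ((((M - 2 * δ j : ℕ)) : ℝ) * Real.log (((M - 2 * δ j : ℕ)) : ℝ) - (((M - 2 * δ j : ℕ)) : ℝ))) +
          2 * r) * n + J * (Real.log ((M : ℝ) * n) / 2 + 1) := by
  rw [log_laiC]
  simp only [log_factorial_eq]
  have hn0 : (0 : ℝ) < n := by exact_mod_cast hn
  have hEn : 0 ≤ logFactErr n := (logFactErr_bounds (m := n) (by omega)).1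
  have hu : ∀ j : Fin J, 1 ≤ M - 2 * δ j := fun j => by have := hδ j; omega
  have hterm : ∀ j : Fin J,
      ((((M - 2 * δ j) * n : ℕ)) : ℝ) * Real.log ((((M - 2 * δ j) * n : ℕ)) : ℝ) - (((M - 2 * δ j) * n : ℕ) : ℝ) +
          logFactErr ((M - 2 * δ j) * n) ≤
        (((M - 2 * δ j : ℕ)) : ℝ) * (n * Real.log n) +
          ((((M - 2 * δ j : ℕ)) : ℝ) * Real.log (((M - 2 * δ j : ℕ)) : ℝ) - (((M - 2 * δ j : ℕ)) : ℝ)) * n +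
          (Real.log ((M : ℝ) * n) / 2 + 1) := by
    intro j
    have hu0 : (0 : ℝ) < (((M - 2 * δ j : ℕ)) : ℝ) := by exact_mod_cast hu j
    have hune : (M - 2 * δ j) * n ≠ 0 := Nat.mul_ne_zero (by have := hu j; omega) (by omega)
    have hE := (logFactErr_bounds hune).2
    have hle : Real.log ((((M - 2 * δ j) * n : ℕ)) : ℝ) ≤ Real.log ((M : ℝ) * n) := by
      refine Real.log_le_log (by positivity) ?_
      have : (((M - 2 * δ j : ℕ)) : ℝ) ≤ M := by exact_mod_cast Nat.sub_le M (2 * δ j)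
      push_cast; nlinarith
    have hsplit : Real.log ((((M - 2 * δ j) * n : ℕ)) : ℝ) = Real.log (((M - 2 * δ j : ℕ)) : ℝ) + Real.log n := by
      push_cast; exact Real.log_mul hu0.ne' hn0.ne'
    rw [Nat.cast_mul, hsplit] at *
    nlinarith [hE, hle, hu0, hn0]
  have hsum : ∑ j, (((((M - 2 * δ j) * n : ℕ)) : ℝ) * Real.log ((((M - 2 * δ j) * n : ℕ)) : ℝ) -
        (((M - 2 * δ j) * n : ℕ) : ℝ) + logFactErr ((M - 2 * δ j) * n)) ≤
      (∑ j, (((M - 2 * δ j : ℕ)) : ℝ)) * (n * Real.log n) +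
        (∑ j, ((((M - 2 * δ j : ℕ)) : ℝ) * Real.log (((M - 2 * δ j : ℕ)) : ℝ) - (((M - 2 * δ j : ℕ)) : ℝ))) * n +
        J * (Real.log ((M : ℝ) * n) / 2 + 1) := by
    calc _ ≤ ∑ j, ((((M - 2 * δ j : ℕ)) : ℝ) * (n * Real.log n) +
          ((((M - 2 * δ j : ℕ)) : ℝ) * Real.log (((M - 2 * δ j : ℕ)) : ℝ) - (((M - 2 * δ j : ℕ)) : ℝ)) * n +
          (Real.log ((M : ℝ) * n) / 2 + 1)) := sum_le_sum fun j _ => hterm j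
      _ = _ := by
        rw [sum_add_distrib, sum_add_distrib, sum_const, card_univ, Fintype.card_fin, nsmul_eq_mul, ← sum_mul,
          ← sum_mul]
  have h2r : -(2 * (r : ℝ) * ((n : ℝ) * Real.log n - n + logFactErr n)) ≤
      -(2 * r) * (n * Real.log n) + 2 * r * n := by nlinarith [hEn, (Nat.cast_nonneg r : (0 : ℝ) ≤ r)]
  linarith [hsum, h2r]

/-! ### The tail estimate -/

/-- The excess `d = Σ_j (M − 2δ_j) − 2r` of denominator over numerator degree growth (a real). [this file] -/
def laiTailD (J r M : ℕ) (δ : Fin J → ℕ) : ℝ := (∑ j, (((M - 2 * δ j : ℕ)) : ℝ)) - 2 * r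

/-- The first-order Stirling constant `c₁ = Σ_j (u_j log u_j − u_j) + 2r` of `log C_n`. [this file] -/
def laiTailC1 (J r M : ℕ) (δ : Fin J → ℕ) : ℝ :=
  (∑ j, ((((M - 2 * δ j : ℕ)) : ℝ) * Real.log (((M - 2 * δ j : ℕ)) : ℝ) - (((M - 2 * δ j : ℕ)) : ℝ))) + 2 * r

/-- `1 ≤ d` under `2r < Σ_j (M − 2δ_j)`. [this file] -/
theorem one_le_laiTailD (hd : 2 * r < ∑ j, (M - 2 * δ j)) : 1 ≤ laiTailD J r M δ := by
  unfold laiTailD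
  have : ((2 * r + 1 : ℕ) : ℝ) ≤ ((∑ j, (M - 2 * δ j) : ℕ) : ℝ) := by exact_mod_cast hd
  push_cast at this
  linarith

/-- The decay exponent as a real: `e_n = d·n + J − 1`. [this file] -/
theorem laiTailExp_cast (hd : 2 * r < ∑ j, (M - 2 * δ j)) (n : ℕ) :
    ((laiTailExp J r M δ n : ℕ) : ℝ) = laiTailD J r M δ * n + J - 1 := by
  have h := (laiTailExp_spec (J := J) (δ := δ) hd n).1
  rw [sum_block_len] at h
  have h' : ((laiTailExp J r M δ n + (2 * r * n + 1) : ℕ) : ℝ) = (((∑ j, (M - 2 * δ j)) * n + J : ℕ) : ℝ) := by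
    exact_mod_cast h
  push_cast at h'
  unfold laiTailD
  linarith

/-- The sub-linear slack is eventually absorbed: `∀ᶠ n, J(log(Mn)/2 + 1) ≤ n`. [this file] -/
theorem eventually_log_slack_le (J M : ℕ) :
    ∀ᶠ n : ℕ in atTop, (J : ℝ) * (Real.log ((M : ℝ) * n) / 2 + 1) ≤ n := by
  have h1 : Tendsto (fun n : ℕ => Real.log ((M : ℝ) * n + 0) / n) atTop (𝓝 0) :=
    tendsto_log_linear_div (Nat.cast_nonneg M) le_rfl
  have h2 := (h1.const_mul ((J : ℝ) / 2)).add (tendsto_const_div_atTop_nhds_zero_nat (J : ℝ))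
  rw [mul_zero, zero_add] at h2
  have h3 : Tendsto (fun n : ℕ => (J : ℝ) * (Real.log ((M : ℝ) * n) / 2 + 1) / n) atTop (𝓝 0) := by
    refine h2.congr' ?_
    filter_upwards [eventually_ge_atTop 1] with n hn
    have hn0 : (n : ℝ) ≠ 0 := by positivity
    rw [add_zero]
    field_simp
  filter_upwards [h3.eventually_lt_const zero_lt_one, eventually_ge_atTop 1] with n hn h1n
  have hn0 : (0 : ℝ) < n := by exact_mod_cast h1n
  exact ((div_lt_one hn0).1 hn).le

/-- **Tail estimate (D3).** If `2 ≤ J`, `2δ_j < M` and `2r < Σ_j (M − 2δ_j)`, then for every `B : ℝ` there is a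
`K : ℕ` with `Σ' k, C_n R_n(k + Kn + 1) ≤ exp(n·B)` for all large `n`. With `B := f(x₀)` this is the `tail` field
of `LaiDecayInputs J r M δ (laiC J r M · δ)`. [this file; DECAY-L1.md Prop. 2.4, tail step] -/
theorem laiTermR_laiC_tail (hJ : 2 ≤ J) (hδ : ∀ j, 2 * δ j < M) (hd : 2 * r < ∑ j, (M - 2 * δ j)) (B : ℝ) :
    ∃ K : ℕ, ∀ᶠ n : ℕ in atTop,
      ∑' k : ℕ, laiTermR J r M n δ (fun m => laiC J r M m δ) (k + K * n + 1) ≤ Real.exp (n * B) := by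
  have hd1 : 1 ≤ laiTailD J r M δ := one_le_laiTailD hd
  -- the per-`n` budget `c₂` and the threshold `K`
  obtain ⟨c₂, hc₂⟩ : ∃ c₂ : ℝ, c₂ = r * Real.log 2 + laiTailC1 J r M δ + Real.log 3 := ⟨_, rfl⟩
  obtain ⟨K, hK1, hK2⟩ : ∃ K : ℕ, M + r + 2 ≤ K ∧ Real.exp ((c₂ - B + 1) / laiTailD J r M δ) ≤ K :=
    ⟨max (M + r + 2) ⌈Real.exp ((c₂ - B + 1) / laiTailD J r M δ)⌉₊, le_max_left _ _,
      (Nat.le_ceil _).trans (by exact_mod_cast le_max_right (M + r + 2) _)⟩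
  refine ⟨K, ?_⟩
  have hKpos : (0 : ℝ) < K := by exact_mod_cast (show 0 < K by omega)
  have hlogK0 : 0 ≤ Real.log K := Real.log_nonneg (by exact_mod_cast (show 1 ≤ K by omega))
  have hKlog : c₂ - B + 1 ≤ laiTailD J r M δ * Real.log K := by
    have h := Real.log_le_log (Real.exp_pos _) hK2
    rw [Real.log_exp, div_le_iff₀ (by linarith)] at h
    linarith
  filter_upwards [eventually_log_slack_le J M, eventually_ge_atTop 1] with n hEn hn
  have hn0 : (0 : ℝ) < n := by exact_mod_cast hn
  have hlogn0 : 0 ≤ Real.log n := Real.log_nonneg (by exact_mod_cast hn)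
  -- the exponent
  obtain ⟨e', he'⟩ : ∃ e', laiTailExp J r M δ n = e' + 2 :=
    ⟨laiTailExp J r M δ n - 2, by have := (laiTailExp_spec (J := J) (δ := δ) hd n).2; omega⟩
  have hecast : ((e' : ℕ) : ℝ) + 1 = laiTailD J r M δ * n + J - 2 := by
    have := laiTailExp_cast (J := J) (δ := δ) hd n
    rw [he'] at this; push_cast at this; linarith
  -- the threshold in terms of `n`
  have hKn : (M + r + 2) * n ≤ K * n := Nat.mul_le_mul_right n hK1
  have hKn' : (M + r + 2) * n = (M + r) * n + 2 * n := by ring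
  have hV : 2 ≤ K * n + 1 := by omega
  have hC := laiC_cast_pos J r M n δ
  have hA : (0 : ℝ) ≤ 3 * 2 ^ (r * n) * ((laiC J r M n δ : ℚ) : ℝ) := by positivity
  -- sum the tail
  have hsum := tsum_le_of_le_div_pow hA (show 2 ≤ laiTailExp J r M δ n by omega) hV
    (fun k => laiTermR J r M n δ (fun m => laiC J r M m δ) (k + K * n + 1))
    (fun k => laiTermR_laiC_nonneg J r M n δ (by omega))
    (fun k => by
      have hk : k + (K * n + 1) = k + K * n + 1 := by ring
      rw [hk]
      exact laiTermR_laiC_le_div_pow hd (by omega))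
  refine hsum.trans ?_
  -- the closed form: A V²/(V^e (V-1)) ≤ A / (Kn)^(e'+1)
  set A : ℝ := 3 * 2 ^ (r * n) * ((laiC J r M n δ : ℚ) : ℝ) with hA_def
  set V : ℝ := ((K * n + 1 : ℕ) : ℝ) with hV_def
  set W : ℝ := (K : ℝ) * n with hW_def
  have hW0 : 0 < W := mul_pos hKpos hn0
  have hVW : V - 1 = W := by rw [hV_def, hW_def]; push_cast; ring
  have hWV : W ≤ V := by linarith
  have hV0 : 0 < V := by linarith
  have hWe : 0 < W ^ e' * W := mul_pos (pow_pos hW0 _) hW0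
  have hstep : A * V ^ 2 / (V ^ laiTailExp J r M δ n * (V - 1)) ≤ A / W ^ (e' + 1) := by
    rw [he', hVW, pow_add, pow_succ W e']
    rw [div_le_div_iff₀ (mul_pos (mul_pos (pow_pos hV0 _) (pow_pos hV0 _)) hW0) hWe]
    have hpow : W ^ e' ≤ V ^ e' := pow_le_pow_left₀ hW0.le hWV e'
    have hAW : 0 ≤ A * W * V ^ 2 := mul_nonneg (mul_nonneg hA hW0.le) (pow_nonneg hV0.le _)
    calc A * V ^ 2 * (W ^ e' * W) = (A * W * V ^ 2) * W ^ e' := by ring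
      _ ≤ (A * W * V ^ 2) * V ^ e' := mul_le_mul_of_nonneg_left hpow hAW
      _ = A * (V ^ e' * V ^ 2 * W) := by ring
  refine hstep.trans ?_
  -- logarithmic bookkeeping
  have hA0 : 0 < A := mul_pos (by positivity) hC
  have hQ0 : 0 < A / W ^ (e' + 1) := div_pos hA0 (pow_pos hW0 _)
  rw [← Real.log_le_iff_le_exp hQ0]
  have hlogQ : Real.log (A / W ^ (e' + 1)) =
      Real.log 3 + (r * n : ℕ) * Real.log 2 + Real.log ((laiC J r M n δ : ℚ) : ℝ) -
        ((e' : ℝ) + 1) * (Real.log K + Real.log n) := by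
    rw [Real.log_div hA0.ne' (pow_pos hW0 _).ne', Real.log_pow, hA_def,
      Real.log_mul (by positivity) hC.ne', Real.log_mul (by norm_num) (by positivity), Real.log_pow, hW_def,
      Real.log_mul hKpos.ne' hn0.ne']
    push_cast
    ring
  rw [hlogQ, hecast]
  have hlaiC : Real.log ((laiC J r M n δ : ℚ) : ℝ) ≤
      laiTailD J r M δ * (n * Real.log n) + laiTailC1 J r M δ * n + J * (Real.log ((M : ℝ) * n) / 2 + 1) :=
    log_laiC_le (J := J) (r := r) (δ := δ) hδ hn
  have hJ2 : (2 : ℝ) ≤ J := by exact_mod_cast hJ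
  have hx1 : 0 ≤ ((J : ℝ) - 2) * (Real.log K + Real.log n) := mul_nonneg (by linarith) (by linarith)
  have hx2 : (n : ℝ) * (c₂ - B + 1) ≤ n * (laiTailD J r M δ * Real.log K) :=
    mul_le_mul_of_nonneg_left hKlog hn0.le
  have hx3 : Real.log 3 ≤ n * Real.log 3 :=
    le_mul_of_one_le_left (Real.log_nonneg (by norm_num)) (by exact_mod_cast hn)
  have hx4 : ((r * n : ℕ) : ℝ) * Real.log 2 = n * (r * Real.log 2) := by push_cast; ring
  have hexp : (laiTailD J r M δ * n + J - 2) * (Real.log K + Real.log n) =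
      n * (laiTailD J r M δ * Real.log K) + laiTailD J r M δ * (n * Real.log n) +
        ((J : ℝ) - 2) * (Real.log K + Real.log n) := by ring
  rw [hexp, hx4]
  have hc₂' : (n : ℝ) * (r * Real.log 2) + laiTailC1 J r M δ * n + n * Real.log 3 = n * c₂ := by
    rw [hc₂]; ring
  have hx5 : (n : ℝ) * (c₂ - B + 1) = n * c₂ - n * B + n := by ring
  linarith [hlaiC, hx1, hx2, hx3, hEn, hc₂', hx5]

end

end Summit.KontsevichZagierPeriods.Zeta5Search
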